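import Summits.CriticalPhenomena.PercolationContinuityZ3.Theorems.PercNearOneGluingNoHeavyLowerTailSahiE3ExchangeDom
import Summits.CriticalPhenomena.PercolationContinuityZ3.Theorems.PercNearOneGluingNoHeavyLowerTailSahiE3ExchangeDomPrincipal
import Mathlib.Tactic.Linarith
import HarnessLib
import HarnessLib.Audit

/-!
# `NoHeavyLowerTail` (crux stmt-CriticalPhenomena-4575), Sahi programme P4: the 2×2 exchange lemma for PRINCIPAL slots (assembly)

Support file (cell `prim-l12`, seat P4, generation 22; `--supports stmt-CriticalPhenomena-4575`).  No named facts, no sorries;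
standard axioms; def-free.

Assembly of `…SahiE3ExchangeDom.exchange_of_dom` (the exchange lemma from the two DOM inequalities under conditional Harris on
the slot) with `…SahiE3ExchangeDomPrincipal.harris_principal_filter` / `harris_upsets` (conditional Harris holds on a principal
filter of a finite distributive lattice carrying a log-supermodular probability weight).  Result: on a finite distributive lattice
with bottom, for a log-supermodular probability weight `μ`, a PRINCIPAL slot `V = {a | t ≤ a}` of positive mass, any configuration of
up-sets `O ⊆ K∩L`, `K∪L ⊆ P`, `O' ⊆ K'∩L'`, `K'∪L' ⊆ P'`, any bracket value `Y ≥ 0` and ANY `R` dominating `μ` on the two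
same-footprints `K∩K'∩V`, `L∩L'∩V` (in particular every `R` in the pair-polytope `P_L(V)`, via the pairs `(K∩K', ⊤)`,
`(L∩L', ⊤)`), the exchange expression of the OR-peel is nonnegative:
`μ(PP'V) + μ(OO'V) − μ(P)μ(O'V) − μ(P')μ(OV) + R(KK'V) + R(LL'V) − need(K,L') − need(L,K') + (1 − μ(V))·Y ≥ 0`.
Product measures on products of finite chains (the Harris blocks of the programme) are log-supermodular, and a conjunction
`x_{i₁} ∧ ⋯ ∧ x_{i_j}` of coordinates is a principal filter, so this is the exchange lemma (both bracket types, all corner classes)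
for principal slots (HOME memo FROM-prim-l12-p4-gen22-SATURATION.md F5).
-/

namespace Summit.CriticalPhenomena.PercolationContinuityZ3.Theorems.SahiE3ExchangePrincipalSlot

open Finset SahiE3ExchangeDom SahiE3ExchangeDomPrincipal
open scoped BigOperators

variable {α : Type*} [DistribLattice α] [Fintype α] [DecidableEq α] [OrderBot α]

/-- **The 2×2 exchange lemma for a principal slot.**  See the module docstring; `need(X,Y) = μ(X)μ(Y∩V) + μ(Y)μ(X∩V) −
μ(V)μ(X)μ(Y)`.  Hypotheses: `μ ≥ 0` log-supermodular of total mass `1`; `V` the principal filter of `t` with `μ(V) > 0`; the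
eight configuration sets are up-sets (closed upwards) with the nestings of a configuration; the two dom inequalities; `Y ≥ 0`.
[this work] -/
theorem exchange_principal_slot (μ R : α → ℝ) (hμ₀ : ∀ a, 0 ≤ μ a) (hμ1 : ∑ a, μ a = 1)
    (hμ : ∀ a b, μ a * μ b ≤ μ (a ⊓ b) * μ (a ⊔ b))
    (t : α) (V K L P O K' L' P' O' : Finset α) (Y : ℝ)
    (hV : ∀ a, a ∈ V ↔ t ≤ a) (hv : 0 < ∑ a ∈ V, μ a)
    (hK : ∀ a ∈ K, ∀ b, a ≤ b → b ∈ K) (hL : ∀ a ∈ L, ∀ b, a ≤ b → b ∈ L)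
    (hP : ∀ a ∈ P, ∀ b, a ≤ b → b ∈ P) (hO : ∀ a ∈ O, ∀ b, a ≤ b → b ∈ O)
    (hK' : ∀ a ∈ K', ∀ b, a ≤ b → b ∈ K') (hL' : ∀ a ∈ L', ∀ b, a ≤ b → b ∈ L')
    (hP' : ∀ a ∈ P', ∀ b, a ≤ b → b ∈ P') (hO' : ∀ a ∈ O', ∀ b, a ≤ b → b ∈ O')
    (hKP : K ⊆ P) (hLP : L ⊆ P) (hOK : O ⊆ K) (hOL : O ⊆ L)
    (hKP' : K' ⊆ P') (hLP' : L' ⊆ P') (hOK' : O' ⊆ K') (hOL' : O' ⊆ L')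
    (hdomK : ∑ b ∈ (K ∩ K') ∩ V, μ b ≤ ∑ b ∈ (K ∩ K') ∩ V, R b)
    (hdomL : ∑ b ∈ (L ∩ L') ∩ V, μ b ≤ ∑ b ∈ (L ∩ L') ∩ V, R b)
    (hY : 0 ≤ Y) :
    0 ≤ (∑ b ∈ (P ∩ P') ∩ V, μ b) + (∑ b ∈ (O ∩ O') ∩ V, μ b)
        - (∑ b ∈ P, μ b) * (∑ b ∈ O' ∩ V, μ b) - (∑ b ∈ P', μ b) * (∑ b ∈ O ∩ V, μ b)
        + (∑ b ∈ (K ∩ K') ∩ V, R b) + (∑ b ∈ (L ∩ L') ∩ V, R b)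
        - ((∑ b ∈ K, μ b) * (∑ b ∈ L' ∩ V, μ b) + (∑ b ∈ L', μ b) * (∑ b ∈ K ∩ V, μ b)
            - (∑ b ∈ V, μ b) * (∑ b ∈ K, μ b) * (∑ b ∈ L', μ b))
        - ((∑ b ∈ L, μ b) * (∑ b ∈ K' ∩ V, μ b) + (∑ b ∈ K', μ b) * (∑ b ∈ L ∩ V, μ b)
            - (∑ b ∈ V, μ b) * (∑ b ∈ L, μ b) * (∑ b ∈ K', μ b))
        + (1 - ∑ b ∈ V, μ b) * Y := by
  -- V is an up-set
  have hVup : ∀ a ∈ V, ∀ b, a ≤ b → b ∈ V := fun a ha b hab => (hV b).2 (le_trans ((hV a).1 ha) hab)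
  -- μ(V) ≤ 1
  have hv1 : ∑ a ∈ V, μ a ≤ 1 := by
    rw [← hμ1]; exact Finset.sum_le_sum_of_subset_of_nonneg (Finset.subset_univ V) fun a _ _ => hμ₀ a
  -- plain Harris with V: v·μ(X) ≤ μ(X∩V)
  have hXV : ∀ X : Finset α, (∀ a ∈ X, ∀ b, a ≤ b → b ∈ X) →
      (∑ b ∈ V, μ b) * (∑ b ∈ X, μ b) ≤ ∑ b ∈ X ∩ V, μ b := by
    intro X hX
    have h := harris_upsets μ hμ₀ hμ V X hVup hX
    rw [hμ1, one_mul, Finset.inter_comm] at h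
    exact h
  -- conditional Harris on V
  have hcXY : ∀ X Z : Finset α, (∀ a ∈ X, ∀ b, a ≤ b → b ∈ X) → (∀ a ∈ Z, ∀ b, a ≤ b → b ∈ Z) →
      (∑ b ∈ X ∩ V, μ b) * (∑ b ∈ Z ∩ V, μ b) ≤ (∑ b ∈ V, μ b) * ∑ b ∈ (X ∩ Z) ∩ V, μ b :=
    fun X Z hX hZ => harris_principal_filter μ hμ₀ hμ t V X Z hV hX hZ
  exact exchange_of_dom μ R hμ₀ V K L P O K' L' P' O' Y hv hv1 hKP hLP hOK hOL hKP' hLP' hOK' hOL'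
    hdomK hdomL (hXV K hK) (hXV L hL) (hXV K' hK') (hXV L' hL') (hXV P hP) (hXV P' hP')
    (hcXY K K' hK hK') (hcXY L L' hL hL') (hcXY P P' hP hP') (hcXY O O' hO hO') hY

end Summit.CriticalPhenomena.PercolationContinuityZ3.Theorems.SahiE3ExchangePrincipalSlot
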